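import Literature.NumberTheory.Transcendental.ShuffleMonoidAlgebra
import Literature.NumberTheory.Transcendental.BrownMotivicMZVExistence
import Literature.NumberTheory.Transcendental.GoncharovFormalIteratedIntegrals
import HarnessLib

/-!
# Brown, *Mixed Tate motives over ℤ* (2012), §2 as THEOREMS: the motivic Galois coaction on
# `𝒪(₀Π₁)` (Deligne–Goncharov) in coordinates, and Brown's `MotivicMZV` package BUILT from it

Sibling file of `BrownMotivicMZV.lean` / `BrownMotivicMZVExistence.lean`, in the cone of the named
fact `Brown2012.motivicMZV_nonempty` (= `Nonempty Brown2012.MotivicMZV`: "the objects of §2 of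
Brown's paper exist"). The structure `Brown2012.MotivicMZV` transcribes seventeen statements of
§§2.2–2.5 and §3.1 about the algebra `H` of motivic multiple zeta values seen inside
`𝒰 = ℚ⟨f₃,f₅,…⟩ ⊗ ℚ[f₂]`. In the paper these are not axioms but CONSEQUENCES of the input quoted
in §2.1 and §2.3 from [Deligne–Goncharov 2005] (and Borel): the motivic Galois group
`G_MT = G_𝒰 ⋊ 𝔾_m` acts on the de Rham fundamental torsor `₀Π₁` of `ℙ¹ ∖ {0,1,∞}`
([DG05, 5.12]), the action factors through Ihara's and its coaction is Goncharov's formula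
([DG05, 5.15], [Goncharov 2005, Thm 1.2] = Brown (2.5), (2.6), (2.18), Theorem 2.4), the ring of
functions `A^MT = 𝒪(G_𝒰)` is the shuffle Hopf algebra `𝒰' = ℚ⟨f₃, f₅, …⟩` with deconcatenation
(Brown (2.20), [DG05, Prop. 2.2–2.3], Borel), and the Zariski closure of the orbit of the Drinfeld
associator `dch` has an even rational base point `γ` through which `H ≅ A' ⊗ ℚ[ζᵐ(2)]`
(Brown §2.3, (2.12)–(2.15), [DG05, 5.20]), the period map being evaluation at `dch` ((2.11), (2.19)).

This file writes that input IN COORDINATES, as a hypothesis bundle `Brown2012.MotivicGaloisData`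
(a `structure`, no named fact, D-0026), every field of which is a statement printed in the sources
about the genuine motivic objects, and then CONSTRUCTS an inhabitant of `MotivicMZV` from it (Brown
§§2.2–2.5 and §3.1 as theorems): `MotivicGaloisData.toMotivicMZV`, whence
`motivicMZV_nonempty_of_galoisData : Nonempty MotivicGaloisData → motivicMZV_nonempty` — the apex
fact now rests on the Deligne–Goncharov-level bundle, every other statement of Brown's §2–§3.1
package being derived.

## The coordinates

* `UAlg = ShuffleMonoidAlgebra ℕ ℕ ℚ` is `𝒰 = ℚ⟨f₃,f₅,…⟩ ⊗ ℚ[f₂]` as a commutative `ℚ`-algebra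
  (`ShuffleMonoidAlgebra.lean`), on the nose of the coordinates `ℕ × List ℕ →₀ ℚ` of
  `BrownDepthOneLift.lean` (`toFinsuppL`; `uW N` = `uWeight N`; `ShuffleMonoidAlgebra.D (2r+1)` =
  `dU r`); `uPrime N ⊆ uW N` is `𝒰'_N` (no `f₂`).
* `UShuffle = ShuffleMonoidAlgebra Unit Bool UAlg` is `𝒰 ⊗_ℚ 𝒪(₀Π₁)`, `𝒪(₀Π₁) = ℚ⟨e⁰,e¹⟩` the
  shuffle algebra on binary words ((2.1); a word `a₁⋯a_N : List Bool`, `false = 0`, `true = 1`, is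
  the function `Iᵐ(0; a₁…a_N; 1)`), with coefficients in `𝒰`: the target of the coaction
  `𝒪(₀Π₁) → A^MT ⊗ 𝒪(₀Π₁)` ((2.5)) read through `A^MT ≅ 𝒰'` ((2.20)).
* Goncharov's formula: for a word `w` and a splitting `sp ∈ splittings w`
  (`GoncharovFormalIteratedIntegrals.lean`: the kept letters `a_{i₁} … a_{i_k}` and the gaps between
  them) the left ("Galois") factor `∏_p Iᵐ(a_{i_p}; a_{i_p+1} … a_{i_{p+1}-1}; a_{i_{p+1}})` is
  `galoisFactor ρ 0 g₀ gaps 1`, the `Iᵐ(a; u; b)` with arbitrary endpoints being reduced to the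
  `Iᵐ(0; u; 1)` by I0, I1, I3 exactly as in the tree (`Brown2012.Im`, `BrownCoactionCalculus.lean`),
  and `ρ : List Bool → 𝒰` standing for the composite `𝒪(₀Π₁) → A' ⊆ A^MT ≅ 𝒰'` of (2.6) and
  (2.20) ("`φ ↦ (g ↦ φ(g·₀1₁))`", restriction to the orbit of the unit path). The coaction of
  `w = Iᵐ(0; a₁…a_N; 1)` is then `coactionG ρ w = Σ_{sp} galoisFactor(sp) ⊗ (kept letters of sp)`
  (Theorem 2.4 with the factors as printed there: Galois factor on the left).

## The hypothesis bundle `MotivicGaloisData` (all fields are printed statements; see each field)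

`ρ` is a graded algebra homomorphism into `𝒰'` ((2.6) is a morphism of graded rings);
the coaction `coactionG ρ` is an algebra homomorphism and a coaction of the Hopf algebra
`(𝒰', ш, deconcatenation)` ([DG05, 5.12]: `G_𝒰` acts on the scheme `₀Π₁`; (2.5); (2.20));
`γ : 𝒪(₀Π₁) → ℚ` is an even rational point of the orbit closure (§2.3, [DG05, 5.20]); and
`dch = g · τ(√t₀) γ` for a real point `(g, t₀)` of `G'_𝒰 × 𝔸¹` (§2.3 (2.13) applied to
`dch ∈ 𝒴(ℝ)`), whose coordinates on the convergent words are the multiple zeta values ((2.11),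
(2.19)) — stated through the derived maps `Ψ` ((2.14)–(2.15) in coordinates:
`Ψ(w) = (id ⊗ ev_{τ(√t)γ}) coactionG(w) ∈ 𝒰' ⊗ ℚ[f₂]`, `f₂ ↔ t`) and `perLin g t₀` (evaluation at
`(g, t₀)`).

## What is proved here

`constCoeff` (the augmentation `x ↦ x(∅)` is an algebra map) and the product formulas
`mul_apply_zero_nil`, `mul_apply_zero_singleton` ("`π` kills products", (3.1)); the gradings
`mul_mem_uW`, `mul_mem_uPrime`; for `Γ : MotivicGaloisData`: `galoisFactor_mem` (graded),
`χ_mul` (the even character `v ↦ γ(v) f₂^{|v|/2}` is multiplicative), the `𝒰`-algebra map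
`Λ : 𝒰 ⊗ 𝒪(₀Π₁) → 𝒰` it induces with `Λ (coactionG w) = Ψ w`, whence **`Ψ` is multiplicative**
(`Ψ_mul`, from `coaction_mul`), `Ψ ∅ = 1`, `Ψ` is graded (`Ψ_mem`), `Ψ(a) = 0` and
`Ψ(a^{n+1}) = 0` for a letter `a` (I0, from `𝒰'_1 = 0` and `γ` even), the `f₂⁰`-part of `Ψ` is `ρ`
(`Ψ_apply_zero`), and **`∂_{2r+1} Ψ(w) = Σ_{sp} [f_{2r+1}](galoisFactor sp) · Ψ(kept sp)`**
(`D_Ψ`, from `coaction_coassoc`) together with its rewriting as Brown's window sum (3.4)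
(`D_Ψ_eq_sum_windows`: only splittings with a single non-empty gap, of length `2r+1`, contribute —
"`π` kills products").

Then the construction (§§2.2–2.3 of the paper): `H` = the `ℚ`-subalgebra of `𝒰` spanned by the
`Ψ(w) = Iᵐ(0;w;1)` (`Halg`, closed under products by I2 = `Ψ_mul`) — Brown's `H = 𝒪(₀Π₁)/J^MT`
identified with its image under the injection (2.15) `H ↪ H^{MT⁺} ≅ 𝒰` ((2.22)), so `φ` is an
inclusion and injectivity is free; `H_N = H ∩ 𝒰_N` (`Hw`); `per = ev_{(g,t₀)}|_H` (`perAlg`, an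
algebra homomorphism because `g` is a character) with (2.19) from `period`;
`∂ʰ_{2r+1} = ∂_{2r+1}|_H` (`dH`; `H` is stable by `D_Ψ`), hence `φ ∘ ∂ʰ = ∂ ∘ φ` tautologically,
(3.3) from the Leibniz rule on `𝒰`, (3.4) from `D_Ψ_eq_sum_windows`, (3.1) from "`π` kills
products", I1, I0, and **(3.8)** from I2 with `Ψ(0) = 0` (`Ψ_zetaOne`:
`0 = Iᵐ(0;0;1)·Iᵐ(0;(10)ⁿ;1) = ζᵐ₁(2ⁿ) + 2 Σ ζᵐ(2ⁱ32ⁿ⁻¹⁻ⁱ)`): `toMotivicMZV`,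
`motivicMZV_nonempty_of_galoisData`. No named fact is introduced (D-0026).

## References

* F. Brown, *Mixed Tate motives over ℤ*, Ann. of Math. **175** (2012), 949–976 (arXiv:1102.1312):
  §2.1 (2.1)–(2.6), §2.2 Def. 2.1, (2.9)–(2.11), §2.3 (2.12)–(2.15), §2.4 I0–I3, Thm 2.4 (2.18),
  (2.19), §2.5 (2.20)–(2.22), Lemma 2.7, §3.1 Def. 3.1, (3.4). [Brown2012]
* P. Deligne, A. B. Goncharov, *Groupes fondamentaux motiviques de Tate mixte*, Ann. Sci. ÉNS **38**
  (2005), 1–56: §§1–2 (Prop. 2.2, 2.3), §5 (5.12, 5.13, 5.15, 5.16, 5.20). [DeligneGoncharov2005]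
* A. B. Goncharov, *Galois symmetries of fundamental groupoids and noncommutative geometry*, Duke
  Math. J. **128** (2005), 209–284, Theorem 1.2. [Goncharov2005]
-/

noncomputable section

open scoped BigOperators

namespace Literature.NumberTheory.Transcendental

namespace Brown2012

open MZV ShuffleMonoidAlgebra
open GoncharovFormalIteratedIntegrals (splittings append_flatMap_eq_of_mem_splittings)

/-! ## `𝒰` and `𝒰 ⊗ 𝒪(₀Π₁)` as commutative algebras -/

/-- Brown's `𝒰 = ℚ⟨f₃, f₅, …⟩ ⊗_ℚ ℚ[f₂]` ((2.21)) as a commutative `ℚ`-algebra: the shuffle monoid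
algebra on the coordinates `ℕ × List ℕ →₀ ℚ` of `BrownDepthOneLift` (`(m, [b₁,…,b_r])` ↔
`f₂^m f_{b₁}⋯f_{b_r}`). [cite: Brown2012, (2.20)–(2.21)] -/
abbrev UAlg : Type := ShuffleMonoidAlgebra ℕ ℕ ℚ

/-- `𝒰 ⊗_ℚ 𝒪(₀Π₁)`, `𝒪(₀Π₁) ≅ ℚ⟨e⁰, e¹⟩` the shuffle algebra on binary words ((2.1)), with
coefficients in `𝒰`: the target of the motivic coaction (2.5) in the coordinates `A^MT ≅ 𝒰'` (2.20).
[cite: Brown2012, (2.1), (2.5), (2.20)] -/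
abbrev UShuffle : Type := ShuffleMonoidAlgebra Unit Bool UAlg

/-- The weight-`N` piece `𝒰_N ⊆ 𝒰` (the tree's `uWeight N` pulled back along the coordinates).
[cite: Brown2012, (2.21)] -/
def uW (N : ℕ) : Submodule ℚ UAlg :=
  (uWeight N).comap (toFinsuppL (M := ℕ) (α := ℕ) (R := ℚ)).toLinearMap

/-- The weight-`N` piece `𝒰'_N` of `𝒰' = ℚ⟨f₃,f₅,…⟩ ⊆ 𝒰` (no `f₂`). [cite: Brown2012, (2.20)] -/
def uPrime (N : ℕ) : Submodule ℚ UAlg :=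
  (Finsupp.supported ℚ ℚ {p : ℕ × List ℕ | p ∈ uBasis N ∧ p.1 = 0}).comap
    (toFinsuppL (M := ℕ) (α := ℕ) (R := ℚ)).toLinearMap

/-- `x ∈ 𝒰_N` iff `x` is supported on Brown's weight-`N` monomials. [cite: Brown2012, (2.21)] -/
theorem mem_uW {N : ℕ} {x : UAlg} : x ∈ uW N ↔ ∀ p, x p ≠ 0 → p ∈ uBasis N := by
  simp only [uW, Submodule.mem_comap, LinearEquiv.coe_coe, toFinsuppL_apply, uWeight,
    Finsupp.mem_supported, Set.subset_def, Finset.mem_coe, Finsupp.mem_support_iff,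
    toFinsupp_apply]

/-- `x ∈ 𝒰'_N` iff `x` is supported on the `f₂`-free weight-`N` monomials. [cite: Brown2012, (2.20)] -/
theorem mem_uPrime {N : ℕ} {x : UAlg} : x ∈ uPrime N ↔ ∀ p, x p ≠ 0 → p ∈ uBasis N ∧ p.1 = 0 := by
  simp only [uPrime, Submodule.mem_comap, LinearEquiv.coe_coe, toFinsuppL_apply,
    Finsupp.mem_supported, Set.subset_def, Finset.mem_coe, Finsupp.mem_support_iff,
    toFinsupp_apply, Set.mem_setOf_eq]

/-- `𝒰'_N ⊆ 𝒰_N`. [cite: Brown2012, (2.21)] -/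
theorem uPrime_le_uW (N : ℕ) : uPrime N ≤ uW N := fun _ hx =>
  mem_uW.2 fun p hp => (mem_uPrime.1 hx p hp).1

/-- In coordinates: `x ∈ uW N ↔ toFinsuppL x ∈ uWeight N`. [folklore] -/
theorem mem_uW_iff_toFinsupp {N : ℕ} {x : UAlg} : x ∈ uW N ↔ x.toFinsupp ∈ uWeight N := Iff.rfl

/-! ### Letters and sums under shuffles -/

/-- The letter sum of a shuffle is the sum of the letter sums. [folklore] -/
theorem sum_of_mem_shuffleWord : ∀ (u v : List ℕ) {w : List ℕ}, w ∈ shuffleWord u v →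
    w.sum = u.sum + v.sum
  | [], v, w, hw => by
    rw [shuffleWord_nil_left, List.mem_singleton] at hw
    subst hw; simp
  | a :: u, [], w, hw => by
    rw [shuffleWord_nil_right, List.mem_singleton] at hw
    subst hw; simp
  | a :: u, b :: v, w, hw => by
    rw [shuffleWord_cons_cons, List.mem_append, List.mem_map, List.mem_map] at hw
    rcases hw with ⟨w', hw', rfl⟩ | ⟨w', hw', rfl⟩
    · rw [List.sum_cons, sum_of_mem_shuffleWord u (b :: v) hw', List.sum_cons, List.sum_cons]
      ring
    · rw [List.sum_cons, sum_of_mem_shuffleWord (a :: u) v hw', List.sum_cons, List.sum_cons]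
      ring

/-- **The weight is multiplicative on `𝒰`**: `𝒰_a · 𝒰_b ⊆ 𝒰_{a+b}`. [cite: Brown2012, (2.21)] -/
theorem mul_mem_uW {a b : ℕ} {x y : UAlg} (hx : x ∈ uW a) (hy : y ∈ uW b) :
    x * y ∈ uW (a + b) := by
  rw [mem_uW] at hx hy ⊢
  intro k hk
  obtain ⟨p, hp, q, hq, h1, h2⟩ := exists_of_mul_apply_ne_zero hk
  obtain ⟨hpo, hps⟩ := hx p hp
  obtain ⟨hqo, hqs⟩ := hy q hq
  refine ⟨fun c hc => ?_, ?_⟩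
  · rcases ShuffleAlgebra.mem_or_mem_of_mem_shuffleWord _ _ h2 c hc with h | h
    · exact hpo c h
    · exact hqo c h
  · rw [h1, sum_of_mem_shuffleWord _ _ h2]; omega

/-- `𝒰'_a · 𝒰'_b ⊆ 𝒰'_{a+b}`. [cite: Brown2012, (2.20)] -/
theorem mul_mem_uPrime {a b : ℕ} {x y : UAlg} (hx : x ∈ uPrime a) (hy : y ∈ uPrime b) :
    x * y ∈ uPrime (a + b) := by
  rw [mem_uPrime]
  intro k hk
  refine ⟨mem_uW.1 (mul_mem_uW (uPrime_le_uW a hx) (uPrime_le_uW b hy)) k hk, ?_⟩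
  obtain ⟨p, hp, q, hq, h1, -⟩ := exists_of_mul_apply_ne_zero hk
  rw [h1, (mem_uPrime.1 hx p hp).2, (mem_uPrime.1 hy q hq).2]

/-- `1 ∈ 𝒰'_0`. [folklore] -/
theorem one_mem_uPrime : (1 : UAlg) ∈ uPrime 0 := by
  classical
  rw [mem_uPrime]
  intro p hp
  rw [one_def, e_def, single_apply] at hp
  split_ifs at hp with h
  · subst h; exact ⟨⟨by simp, by simp⟩, rfl⟩
  · exact absurd rfl hp

/-- `single (0, []) c ∈ 𝒰'_0`. [folklore] -/
theorem single_zero_nil_mem_uPrime (c : ℚ) :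
    (ShuffleMonoidAlgebra.single (0, []) c : UAlg) ∈ uPrime 0 := by
  rw [← smul_e, ← one_def]
  exact Submodule.smul_mem _ c one_mem_uPrime

/-- `single (N/2, []) c ∈ 𝒰_N` for `N` even (`f₂^{N/2}`). [cite: Brown2012, (2.21)] -/
theorem single_half_nil_mem_uW {N : ℕ} (hN : Even N) (c : ℚ) :
    (ShuffleMonoidAlgebra.single (N / 2, []) c : UAlg) ∈ uW N := by
  classical
  rw [mem_uW]
  intro p hp
  rw [single_apply] at hp
  split_ifs at hp with h
  · subst h
    refine ⟨by simp, ?_⟩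
    obtain ⟨k, rfl⟩ := hN
    simp; omega
  · exact absurd rfl hp

/-- An element of `𝒰_a`, `a ≥ 1`, has no constant term. [cite: Brown2012, (2.21)] -/
theorem apply_zero_nil_eq_zero_of_mem_uW {a : ℕ} {x : UAlg} (hx : x ∈ uW a) (ha : 1 ≤ a) :
    x (0, []) = 0 := by
  by_contra h
  have := (mem_uW.1 hx _ h).2
  simp at this; omega

/-- An element of `𝒰_a` has no `f_n`-term for `n ≠ a`. [cite: Brown2012, (2.21)] -/
theorem apply_zero_singleton_eq_zero_of_mem_uW {a n : ℕ} {x : UAlg} (hx : x ∈ uW a)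
    (h : a ≠ n) : x (0, [n]) = 0 := by
  by_contra h'
  have := (mem_uW.1 hx _ h').2
  simp at this; omega

/-- `𝒰_1 = 0` (there is no letter of degree `1`). [cite: Brown2012, (2.21) and Lemma 2.5] -/
theorem eq_zero_of_mem_uW_one {x : UAlg} (hx : x ∈ uW 1) : x = 0 := by
  ext ⟨m, w⟩
  rw [ShuffleMonoidAlgebra.zero_apply]
  by_contra h
  obtain ⟨hodd, hsum⟩ := mem_uW.1 hx _ h
  rcases w with _ | ⟨c, w⟩
  · simp at hsum
  · have h3 := (hodd c (by simp)).2
    simp only [List.sum_cons] at hsum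
    omega

/-! ### The augmentation and "π kills products" -/

/-- The constant term `x ↦ x(∅)` (`f₂`-degree `0`, empty word) is an algebra homomorphism
`𝒰 → ℚ` (the counit of `𝒰'` extended by `f₂ ↦ 0`). [cite: Brown2012, (2.20)] -/
def constCoeff : UAlg →ₐ[ℚ] ℚ :=
  lift (fun p => if p = (0, []) then 1 else 0) (if_pos rfl) (by
    rintro ⟨m, u⟩ ⟨m', v⟩
    by_cases h : (m, u) = ((0 : ℕ), ([] : List ℕ)) ∧ (m', v) = ((0 : ℕ), ([] : List ℕ))
    · obtain ⟨h1, h2⟩ := h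
      simp only [Prod.mk.injEq] at h1 h2
      obtain ⟨rfl, rfl⟩ := h1; obtain ⟨rfl, rfl⟩ := h2
      simp
    · have hl : ((if ((m, u) : ℕ × List ℕ) = (0, []) then (1 : ℚ) else 0) *
          if ((m', v) : ℕ × List ℕ) = (0, []) then 1 else 0) = 0 := by
        split_ifs with h1 h2
        · exact absurd ⟨h1, h2⟩ h
        · exact mul_zero _
        · exact zero_mul _
        · exact zero_mul _
      rw [hl, eq_comm]
      refine List.sum_eq_zero fun r hr => ?_
      obtain ⟨t, ht, rfl⟩ := List.mem_map.1 hr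
      rw [if_neg]
      intro heq
      simp only [Prod.mk.injEq] at heq
      obtain ⟨hm, ht0⟩ := heq
      have hlen := length_of_mem_shuffleWord u v ht
      rw [ht0, List.length_nil] at hlen
      have hu : u = [] := List.eq_nil_of_length_eq_zero (by omega)
      have hv : v = [] := List.eq_nil_of_length_eq_zero (by omega)
      subst hu; subst hv
      exact h ⟨by simp [Prod.mk.injEq]; omega, by simp [Prod.mk.injEq]; omega⟩)

/-- `constCoeff x = x (0, ∅)`. [folklore] -/
theorem constCoeff_apply (x : UAlg) : constCoeff x = x (0, []) := by
  classical
  rw [constCoeff, lift_apply, Finset.sum_eq_single (0, []), if_pos rfl, smul_eq_mul, mul_one]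
  · intro p _ hp; rw [if_neg hp, smul_zero]
  · intro h; rw [Finsupp.mem_support_iff, not_not, toFinsupp_apply] at h; rw [h, zero_smul]

/-- **The constant term is multiplicative**: `(x y)(∅) = x(∅) y(∅)`. [folklore] -/
theorem mul_apply_zero_nil (x y : UAlg) : (x * y) (0, []) = x (0, []) * y (0, []) := by
  rw [← constCoeff_apply, ← constCoeff_apply, ← constCoeff_apply, map_mul]

/-- **"`π` kills products" ((3.1)) in `𝒰`**: the coefficient of the one-letter word `f_n` in a
product, `(x y)(f_n) = x(f_n) y(∅) + x(∅) y(f_n)` (the letter `f_n` of a shuffle comes from one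
factor, the other factor contributing its constant term). [cite: Brown2012, (3.1)] -/
theorem mul_apply_zero_singleton (x y : UAlg) (n : ℕ) :
    (x * y) (0, [n]) = x (0, [n]) * y (0, []) + x (0, []) * y (0, [n]) := by
  have key : ∀ z : UAlg, z (0, [n]) = constCoeff (D n z) := fun z => by
    rw [constCoeff_apply, D_apply]
  rw [key, D_mul, map_add, map_mul, map_mul, ← key, ← key, constCoeff_apply, constCoeff_apply]

/-- The product of two positive-weight elements has no one-letter term.
[cite: Brown2012, (3.1)] -/
theorem mul_apply_zero_singleton_eq_zero {a b : ℕ} {x y : UAlg} (ha : 1 ≤ a) (hb : 1 ≤ b)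
    (hx : x ∈ uW a) (hy : y ∈ uW b) (n : ℕ) : (x * y) (0, [n]) = 0 := by
  rw [mul_apply_zero_singleton, apply_zero_nil_eq_zero_of_mem_uW hx ha,
    apply_zero_nil_eq_zero_of_mem_uW hy hb, mul_zero, zero_mul, add_zero]

/-! ## Goncharov's formula in coordinates: the Galois factor of a splitting -/

section Galois

variable (ρ : List Bool → UAlg)

/-- **The Galois (left) factor of Goncharov's coproduct for a splitting**, through `ρ`:
`galoisFactor ρ x g₀ [(k₁,g₁),…,(k_r,g_r)] b = Iᵐ_ρ(x; g₀; k₁) Iᵐ_ρ(k₁; g₁; k₂) ⋯ Iᵐ_ρ(k_r; g_r; b)`,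
where `Iᵐ_ρ(a; u; b) = Im ρ a u b` is the tree's reduction of `Iᵐ(a;u;b)` to the `Iᵐ(0;u;1)` by
I0, I1, I3 ("the formula involves `𝒪(ₐΠ_b)` for all `a, b` but can easily be rewritten in terms of
`𝒪(₀Π₁)` only"), mirroring `GoncharovFormalIteratedIntegrals.gapProd`.
[cite: Brown2012, §2.1 and Theorem 2.4 (2.18)] -/
def galoisFactor : Bool → List Bool → List (Bool × List Bool) → Bool → UAlg
  | x, g, [], b => Im ρ x g b
  | x, g, p :: ps, b => Im ρ x g p.1 * galoisFactor p.1 p.2 ps b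

/-- The kept letters `a_{i₁} ⋯ a_{i_k}` of a splitting (the right factor `Iᵐ(0; a_{i₁}…a_{i_k}; 1)`
of Theorem 2.4). [cite: Brown2012, Theorem 2.4 (2.18)] -/
def kept (ps : List (Bool × List Bool)) : List Bool := ps.map Prod.fst

/-- The total length of the gaps of a splitting. [folklore] -/
def gapLength (g : List Bool) (ps : List (Bool × List Bool)) : ℕ :=
  g.length + (ps.map fun p => p.2.length).sum

omit ρ in
/-- `|w| = (total gap length) + (number of kept letters)` for a splitting of `w`. [folklore] -/
theorem length_eq_gapLength_add {w : List Bool} {sp : List Bool × List (Bool × List Bool)}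
    (h : sp ∈ splittings w) : w.length = gapLength sp.1 sp.2 + (kept sp.2).length := by
  rw [← append_flatMap_eq_of_mem_splittings w h, gapLength, kept, List.length_append,
    List.length_map]
  suffices hs : ∀ L : List (Bool × List Bool),
      (L.flatMap fun q => q.1 :: q.2).length = (L.map fun p => p.2.length).sum + L.length by
    rw [hs]; omega
  intro L
  induction L with
  | nil => rfl
  | cons q L ih => simp only [List.flatMap_cons, List.length_append, List.length_cons, ih,
      List.map_cons, List.sum_cons]; omega

/-- **The motivic coaction in coordinates** (Goncharov's formula, Theorem 2.4, with the Galois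
factor on the left as printed): `coactionG ρ (a₁⋯a_N) = Σ_{splittings} galoisFactor ⊗ kept`, an
element of `𝒰 ⊗ 𝒪(₀Π₁)` = functions on binary words with values in `𝒰`.
[cite: Brown2012, (2.5), (2.6) and Theorem 2.4 (2.18)] -/
def coactionG (w : List Bool) : UShuffle :=
  ((splittings w).map fun sp =>
    (ShuffleMonoidAlgebra.single ((), kept sp.2) (galoisFactor ρ false sp.1 sp.2 true) :
      UShuffle)).sum

/-- The character `v ↦ γ(v) f₂^{|v|/2}` of `𝒪(₀Π₁)` with values in `ℚ[f₂] ⊆ 𝒰`: evaluation at the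
point `τ(√t).γ` ("`τ(λ)` multiplies elements of degree `d` by `λ^d`", `γ` even, `t ↔ f₂`).
[cite: Brown2012, §2.3 (2.12)–(2.13)] -/
def χ (γ : List Bool → ℚ) (v : List Bool) : UAlg :=
  ShuffleMonoidAlgebra.single (v.length / 2, []) (γ v)

/-- **Brown's map `𝒪(₀Π₁) → H ↪ A' ⊗ ℚ[ζᵐ(2)] ⊆ 𝒰` in coordinates** ((2.9), (2.13)–(2.15), (2.22)):
the function `w` restricted to the orbit `{g τ(√t) γ}` and read in `A^MT ⊗ ℚ[t] ≅ 𝒰`, i.e.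
`Ψ(w) = (id ⊗ ev_{τ(√t)γ})(coactionG w) = Σ_{sp} galoisFactor(sp) · γ(kept) f₂^{|kept|/2}`.
Its value on `a₁⋯a_N` is the motivic iterated integral `Iᵐ(0; a₁…a_N; 1)` seen in `𝒰`.
[cite: Brown2012, (2.9), (2.13)–(2.15)] -/
def Ψ (γ : List Bool → ℚ) (w : List Bool) : UAlg :=
  ((splittings w).map fun sp => galoisFactor ρ false sp.1 sp.2 true * χ γ (kept sp.2)).sum

end Galois

/-- The prefix coefficient `(L_a x)(m, b) = x(m, a b)`: the `(f_a ⊗ ·)`-component of the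
deconcatenation coproduct `Δ x = Σ_a f_a ⊗ L_a x` of `𝒰'` ((2.20)), extended `f₂`-linearly; for a
single letter `L_{f_n} = ∂_n` (`ShuffleMonoidAlgebra.D n`). [cite: Brown2012, (2.20)] -/
def prefixCoeff : List ℕ → UAlg →ₗ[ℚ] UAlg
  | [] => LinearMap.id
  | n :: a => prefixCoeff a ∘ₗ D n

/-- `(L_a x)(m, b) = x(m, a ++ b)`. [cite: Brown2012, (2.20)] -/
@[simp] theorem prefixCoeff_apply : ∀ (a : List ℕ) (x : UAlg) (p : ℕ × List ℕ),
    prefixCoeff a x p = x (p.1, a ++ p.2)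
  | [], x, p => rfl
  | n :: a, x, p => by
    rw [prefixCoeff, LinearMap.comp_apply, prefixCoeff_apply a, D_apply, List.cons_append]

/-- `L_{[n]} = ∂_n`. [cite: Brown2012, (2.20) and proof of Lemma 2.7] -/
theorem prefixCoeff_singleton (n : ℕ) : prefixCoeff [n] = D n := rfl

/-- The period functional `𝒰 → ℝ`, `f₂^m f_b ↦ t₀^m g(b)`: evaluation at the real point `(g, t₀)` of
`G'_𝒰 × 𝔸¹` (linear version; an algebra map once `g` is a character, `perAlg`).
[cite: Brown2012, (2.11) and §2.3 (2.13)] -/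
def perLin (g : List ℕ → ℝ) (t₀ : ℝ) : UAlg →ₗ[ℚ] ℝ := liftLin fun p => t₀ ^ p.1 * g p.2

/-! ## The hypothesis bundle -/

/-- **The Deligne–Goncharov input of Brown's §2, in coordinates** (hypothesis bundle; every field
is a statement printed in the sources about the genuine motivic objects, read through a fixed
isomorphism `A^MT ≅ 𝒰' = ℚ⟨f₃,f₅,…⟩` of graded Hopf algebras, (2.20), [DG05, Prop. 2.2–2.3] and
Borel):

* `ρ` — the map (2.6) `𝒪(₀Π₁) → A'`, `φ ↦ (g ↦ φ(g·₀1₁))` (restriction to the orbit of the unit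
  path along `G'_𝒰 → A ≅ ₀Π₁`, (2.4)), followed by `A' ⊆ A^MT ≅ 𝒰'`: a graded algebra
  homomorphism (`ρ_nil`, `ρ_mul`, `ρ_mem`);
* the coaction (2.5) of `A^MT` on `𝒪(₀Π₁)` "is obtained by composing `Δ` of [Goncharov's
  formula, Thm 2.4] with the map (2.6) applied to the left-hand factor", i.e. it IS
  `coactionG ρ`; being the coaction of the Hopf algebra `𝒪(G_𝒰) = (𝒰', ш, deconcatenation)` dual
  to the action of the group scheme `G_𝒰` on the scheme `₀Π₁` [DG05, 5.12], it is an algebra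
  homomorphism (`coaction_mul`) and coassociative (`coaction_coassoc`, written on the
  `f_a ⊗ · ⊗ ·`-components);
* `γ` — an even rational point of `𝒴 = Spec H` = the Zariski closure of the orbit of `dch`
  (§2.3: "Let us choose a rational point `γ ∈ 𝒴(ℚ)` which is even, i.e. `τ(-1)γ = γ`",
  [DG05, 5.20]): a character of `𝒪(₀Π₁)` vanishing in odd degrees (`γ_nil`, `γ_mul`, `γ_odd`);
* `g`, `t₀` — by the isomorphism `G'_𝒰 × 𝔸¹ ≅ 𝒴`, `(g, t) ↦ g τ(√t).γ` of §2.3 (2.13), the real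
  point `dch ∈ 𝒴(ℝ)` ([DG05, 5.16]) is `g τ(√t₀) γ` for a real point `g` of `G'_𝒰` (a real character
  of `𝒰'`, `g_nil`, `g_mul`) and `t₀ ∈ ℝ`;
* `period` — the coefficients of `dch` on the convergent words are the multiple zeta values:
  `per Iᵐ(0; ρ(n₁,…,n_r); 1) = ζ(n₁,…,n_r)` for `n_r ≥ 2` ((2.11), (2.19); the tree's
  `multipleZeta` sums in the opposite order, whence `s.reverse`, exactly as in
  `MotivicMZV.per_J`), the function `w ↦ ⟨w, g τ(√t₀) γ⟩` being `perLin g t₀ (Ψ ρ γ w)`.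

No normalisation ((3.6)) and no injectivity are assumed; `BrownMotivicMZVOfGaloisData` derives
Brown's `MotivicMZV` from this. [cite: Brown2012, §2.1 (2.4)–(2.6), §2.3 (2.12)–(2.15), Thm 2.4,
(2.11), (2.19), (2.20)] -/
structure MotivicGaloisData where
  /-- (2.6) followed by `A' ⊆ A^MT ≅ 𝒰'`: the word `w ∈ 𝒪(₀Π₁)` restricted to the `G_𝒰`-orbit of
  the unit path `₀1₁`. -/
  ρ : List Bool → UAlg
  /-- (2.6) is unital. -/
  ρ_nil : ρ [] = 1
  /-- (2.6) is an algebra homomorphism for the shuffle product of `𝒪(₀Π₁)` ((2.1)). -/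
  ρ_mul : ∀ u v : List Bool, ρ u * ρ v = ((shuffleWord u v).map ρ).sum
  /-- (2.6) is graded (`𝔾_m`-equivariant) with values in `A' ⊆ A^MT ≅ 𝒰'` ((2.20)):
  `ρ(w) ∈ 𝒰'_{|w|}`. -/
  ρ_mem : ∀ w : List Bool, ρ w ∈ uPrime w.length
  /-- The coaction (2.5) = Goncharov's formula through (2.6) (Thm 2.4) is an algebra homomorphism
  `𝒪(₀Π₁) → A^MT ⊗ 𝒪(₀Π₁)` (it is dual to the action morphism `G_𝒰 × ₀Π₁ → ₀Π₁`, [DG05, 5.12]). -/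
  coaction_mul : ∀ u v : List Bool,
    coactionG ρ u * coactionG ρ v = ((shuffleWord u v).map (coactionG ρ)).sum
  /-- The coaction (2.5) is coassociative for the deconcatenation coproduct of `A^MT ≅ 𝒰'`
  ((2.20)): the `f_a ⊗ · ⊗ ·`-component of `(Δ ⊗ id) ∘ Δ = (id ⊗ Δ) ∘ Δ` on a word `w`,
  `Σ_{sp} L_a(galoisFactor sp) ⊗ kept(sp) = Σ_{sp} [f_a](galoisFactor sp) · coactionG (kept sp)`
  ([DG05, 5.12]: (2.5) is the coaction of the Hopf algebra `𝒪(G_𝒰)`). -/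
  coaction_coassoc : ∀ (w : List Bool) (a : List ℕ),
    ((splittings w).map fun sp =>
      (ShuffleMonoidAlgebra.single ((), kept sp.2)
        (prefixCoeff a (galoisFactor ρ false sp.1 sp.2 true)) : UShuffle)).sum =
    ((splittings w).map fun sp =>
      algebraMap ℚ UAlg (galoisFactor ρ false sp.1 sp.2 true (0, a)) •
        coactionG ρ (kept sp.2)).sum
  /-- The even rational base point `γ ∈ 𝒴(ℚ) ⊆ ₀Π₁(ℚ)` of §2.3: its coordinates `w ↦ ⟨w, γ⟩`. -/
  γ : List Bool → ℚ
  /-- `γ` is a point of `₀Π₁` (a group-like series): `⟨∅, γ⟩ = 1`. -/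
  γ_nil : γ [] = 1
  /-- `γ` is a point of `₀Π₁`: a character of the shuffle algebra `𝒪(₀Π₁)` ((2.1)). -/
  γ_mul : ∀ u v : List Bool, γ u * γ v = ((shuffleWord u v).map γ).sum
  /-- `γ` is even, `τ(-1)γ = γ`: it vanishes on words of odd length (§2.3). -/
  γ_odd : ∀ w : List Bool, Odd w.length → γ w = 0
  /-- The real point `g ∈ G'_𝒰(ℝ)` with `dch = g τ(√t₀) γ` (§2.3 (2.13) at `dch ∈ 𝒴(ℝ)`): its
  coordinates `f_b ↦ g(b)` on `𝒰' ≅ A^MT → A'`. -/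
  g : List ℕ → ℝ
  /-- `g` is a point: `g(∅) = 1`. -/
  g_nil : g [] = 1
  /-- `g` is a point of `G_𝒰 = Spec 𝒰'`: a character of the shuffle algebra `𝒰'` ((2.20)). -/
  g_mul : ∀ a b : List ℕ, g a * g b = ((shuffleWord a b).map g).sum
  /-- The parameter `t₀ ∈ ℝ` of `dch = g τ(√t₀) γ` (§2.3: "retrieved by taking the coefficient
  of `e₀e₁`"). -/
  t₀ : ℝ
  /-- (2.11), (2.19): the period map is evaluation at `dch = g τ(√t₀) γ`, and
  `per ζᵐ(n₁,…,n_r) = ζ(n₁,…,n_r)` for `n_r ≥ 2` (Brown sums `0 < k₁ < ⋯ < k_r`, the tree's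
  `multipleZeta` the reverse). -/
  period : ∀ s : List ℕ, IsAdmissible s →
    perLin g t₀ (Ψ ρ γ (rho s.reverse)) = multipleZeta s

/-! ### Divided powers: a multiplicative function killing a letter kills its powers -/

/-- If `f : 𝒪(₀Π₁) → 𝒰` is multiplicative for the shuffle product and kills the letter `a`, it kills
all the words `aⁿ⁺¹` (`a ш aⁿ⁺¹ = (n+2) aⁿ⁺²` and `𝒰` is a `ℚ`-vector space): the mechanism of I0,
second clause. [cite: Brown2012, §2.4 I0] -/
theorem apply_replicate_succ_eq_zero {f : List Bool → UAlg}
    (hmul : ∀ u v : List Bool, f u * f v = ((shuffleWord u v).map f).sum) (a : Bool)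
    (h1 : f [a] = 0) : ∀ n : ℕ, f (List.replicate (n + 1) a) = 0
  | 0 => h1
  | n + 1 => by
    have h := hmul [a] (List.replicate (n + 1) a)
    rw [h1, zero_mul] at h
    have hall : ∀ w ∈ shuffleWord [a] (List.replicate (n + 1) a),
        f w = f (List.replicate (n + 2) a) := by
      intro w hw
      congr 1
      rw [List.eq_replicate_iff]
      refine ⟨by have := length_of_mem_shuffleWord _ _ hw; simp at this; omega, fun c hc => ?_⟩
      rcases ShuffleAlgebra.mem_or_mem_of_mem_shuffleWord _ _ hw c hc with h' | h'
      · simpa using h'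
      · exact List.eq_of_mem_replicate h'
    rw [List.map_congr_left hall, List.map_const', List.sum_replicate, length_shuffleWord,
      List.length_singleton, List.length_replicate, ← Nat.cast_smul_eq_nsmul ℚ] at h
    have hc : ((Nat.choose (1 + (n + 1)) 1 : ℕ) : ℚ) ≠ 0 := by
      rw [Nat.cast_ne_zero]; exact (Nat.choose_pos (by omega)).ne'
    exact (smul_eq_zero.1 h.symm).resolve_left hc

/-- `single p` is additive over list sums. [folklore] -/
theorem single_list_sum {ι : Type*} (p : ℕ × List ℕ) (L : List ι) (f : ι → ℚ) :
    (ShuffleMonoidAlgebra.single p (L.map f).sum : UAlg) =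
      (L.map fun i => ShuffleMonoidAlgebra.single p (f i)).sum := by
  induction L with
  | nil => simp
  | cons i L ih => rw [List.map_cons, List.sum_cons, single_add, ih, List.map_cons, List.sum_cons]

/-- **The splitting with no kept letter is the only one contributing** to a sum whose terms vanish
whenever a letter is kept: `Σ_{sp ∈ splittings u} F sp = F (u, ∅)`. [folklore] -/
theorem sum_splittings_eq_of_kept_ne_nil {N : Type*} [AddCommMonoid N] :
    ∀ (u : List Bool) (F : List Bool × List (Bool × List Bool) → N),
      (∀ sp ∈ splittings u, kept sp.2 ≠ [] → F sp = 0) → ((splittings u).map F).sum = F (u, [])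
  | [], F, _ => by simp [splittings]
  | c :: w, F, hF => by
    rw [splittings, List.map_append, List.sum_append, List.map_map, List.map_map]
    have h2 : ((splittings w).map (F ∘ fun p => (([] : List Bool), (c, p.1) :: p.2))).sum = 0 :=
      List.sum_eq_zero fun x hx => by
        obtain ⟨p, hp, rfl⟩ := List.mem_map.1 hx
        exact hF _ (by rw [splittings]; exact List.mem_append_right _ (List.mem_map.2 ⟨p, hp, rfl⟩))
          (by simp [kept])
    rw [h2, add_zero]
    exact sum_splittings_eq_of_kept_ne_nil w (F ∘ fun p => (c :: p.1, p.2)) fun p hp hk =>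
      hF _ (by rw [splittings]; exact List.mem_append_left _ (List.mem_map.2 ⟨p, hp, rfl⟩)) hk

namespace MotivicGaloisData

variable (Γ : MotivicGaloisData)

/-! ### `ρ` and the Galois factors are graded; `𝒰'_1 = 0` -/

/-- `ρ` kills letters: `𝒰'_1 = 0`. [cite: Brown2012, (2.20) and §2.4 I0] -/
theorem ρ_singleton (a : Bool) : Γ.ρ [a] = 0 :=
  eq_zero_of_mem_uW_one (uPrime_le_uW 1 (Γ.ρ_mem [a]))

/-- `ρ` kills the constant words `aⁿ⁺¹` (I0, second clause, on the Galois side).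
[cite: Brown2012, §2.4 I0] -/
theorem ρ_replicate_succ (a : Bool) (n : ℕ) : Γ.ρ (List.replicate (n + 1) a) = 0 :=
  apply_replicate_succ_eq_zero Γ.ρ_mul a (Γ.ρ_singleton a) n

/-- `Iᵐ_ρ(a; u; b) ∈ 𝒰'_{|u|}` (I0, I1, I3 preserve the grading). [cite: Brown2012, §2.4 and (2.16)] -/
theorem Im_ρ_mem (a : Bool) (u : List Bool) (b : Bool) : Im Γ.ρ a u b ∈ uPrime u.length := by
  unfold Im
  split_ifs with hu hab ha
  · subst hu; rw [Γ.ρ_nil]; exact one_mem_uPrime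
  · exact Submodule.zero_mem _
  · exact Γ.ρ_mem u
  · rw [← List.length_reverse]; exact Submodule.smul_mem _ _ (Γ.ρ_mem u.reverse)

/-- **The Galois factor of a splitting is homogeneous of degree the total gap length.**
[cite: Brown2012, Theorem 2.4 and (2.16)] -/
theorem galoisFactor_mem : ∀ (x : Bool) (g : List Bool) (ps : List (Bool × List Bool)) (b : Bool),
    galoisFactor Γ.ρ x g ps b ∈ uPrime (gapLength g ps)
  | x, g, [], b => by
    rw [galoisFactor, gapLength, List.map_nil, List.sum_nil, add_zero]; exact Γ.Im_ρ_mem x g b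
  | x, g, p :: ps, b => by
    rw [galoisFactor, gapLength, List.map_cons, List.sum_cons, ← add_assoc,
      show g.length + p.2.length + (ps.map fun q => q.2.length).sum =
        g.length + gapLength p.2 ps by rw [gapLength]; ring]
    exact mul_mem_uPrime (Γ.Im_ρ_mem x g p.1) (galoisFactor_mem p.1 p.2 ps b)

/-! ### The even character `χ = ev_{τ(√t)γ}` and the `𝒰`-algebra map `Λ = id ⊗ χ` -/

/-- `γ` kills letters (odd length). [cite: Brown2012, §2.3] -/
theorem γ_singleton (a : Bool) : Γ.γ [a] = 0 := Γ.γ_odd [a] (by simp)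

/-- `χ(∅) = 1`. [cite: Brown2012, §2.3] -/
theorem χ_nil : χ Γ.γ [] = 1 := by
  rw [χ, List.length_nil, Nat.zero_div, Γ.γ_nil]; rfl

/-- `χ(v) = 0` for `|v|` odd (`γ` is even). [cite: Brown2012, §2.3] -/
theorem χ_of_odd {v : List Bool} (h : Odd v.length) : χ Γ.γ v = 0 := by
  rw [χ, Γ.γ_odd v h, single_zero]

/-- `χ(v) ∈ 𝒰_{|v|}` (`f₂^{|v|/2}` for `|v|` even, `0` for `|v|` odd). [cite: Brown2012, §2.3 and (2.21)] -/
theorem χ_mem (v : List Bool) : χ Γ.γ v ∈ uW v.length := by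
  rcases Nat.even_or_odd v.length with h | h
  · exact single_half_nil_mem_uW h _
  · rw [Γ.χ_of_odd h]; exact Submodule.zero_mem _

/-- **`χ` is a character of `𝒪(₀Π₁)`** (`γ` is a point and `τ(√t)` an automorphism; the parity
bookkeeping is `γ` being even). [cite: Brown2012, §2.3 (2.12)–(2.13)] -/
theorem χ_mul (u v : List Bool) : χ Γ.γ u * χ Γ.γ v = ((shuffleWord u v).map (χ Γ.γ)).sum := by
  have hR : ((shuffleWord u v).map (χ Γ.γ)).sum = ShuffleMonoidAlgebra.single
      ((u.length + v.length) / 2, []) (Γ.γ u * Γ.γ v) := by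
    rw [Γ.γ_mul, single_list_sum]
    refine congrArg List.sum (List.map_congr_left fun t ht => ?_)
    rw [χ, length_of_mem_shuffleWord u v ht]
  have hL : χ Γ.γ u * χ Γ.γ v =
      ShuffleMonoidAlgebra.single (u.length / 2 + v.length / 2, []) (Γ.γ u * Γ.γ v) := by
    rw [χ, χ, single_mul_single]
    simp only [mulBasis, shuffleWord_nil_left, List.map_singleton, List.sum_singleton]
    rw [smul_e]
  rw [hL, hR]
  by_cases h : Γ.γ u * Γ.γ v = 0
  · rw [h, single_zero, single_zero]
  · have hu : Even u.length := by
      by_contra hu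
      exact h (by rw [Γ.γ_odd u (Nat.not_even_iff_odd.1 hu), zero_mul])
    have hv : Even v.length := by
      by_contra hv
      exact h (by rw [Γ.γ_odd v (Nat.not_even_iff_odd.1 hv), mul_zero])
    obtain ⟨a, ha⟩ := hu
    obtain ⟨b, hb⟩ := hv
    rw [ha, hb]
    congr 2
    omega

/-- **`Λ = id ⊗ ev_{τ(√t)γ} : 𝒰 ⊗ 𝒪(₀Π₁) → 𝒰 ⊗ ℚ[t] = 𝒰`**, the `𝒰`-algebra homomorphism
extending the character `χ` (universal property of the shuffle monoid algebra).
[cite: Brown2012, §2.3 (2.13)] -/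
def Λ : UShuffle →ₐ[UAlg] UAlg :=
  lift (fun p => χ Γ.γ p.2) Γ.χ_nil (fun p q => Γ.χ_mul p.2 q.2)

/-- `Λ (x ⊗ v) = x · χ(v)`. [cite: Brown2012, §2.3 (2.13)] -/
@[simp] theorem Λ_single (v : List Bool) (x : UAlg) :
    Γ.Λ (ShuffleMonoidAlgebra.single ((), v) x) = x * χ Γ.γ v := by
  rw [Λ, lift_single, smul_eq_mul]

/-- **`Ψ = Λ ∘ coactionG`**: `Ψ(w) = (id ⊗ ev_{τ(√t)γ})(Δ w)` — the function `w` on the orbit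
`G_𝒰 τ(√t) γ`, in coordinates. [cite: Brown2012, §2.3 (2.13)–(2.15)] -/
theorem Λ_coactionG (w : List Bool) : Γ.Λ (coactionG Γ.ρ w) = Ψ Γ.ρ Γ.γ w := by
  rw [coactionG, map_list_sum, List.map_map, Ψ]
  exact congrArg List.sum (List.map_congr_left fun sp _ => Γ.Λ_single _ _)

/-! ### `Ψ` is multiplicative, unital, graded; I0 -/

/-- **I2 for the constructed motivic iterated integrals: `Ψ` is multiplicative for the shuffle
product**, `Ψ(u) Ψ(v) = Σ_{w ∈ u ш v} Ψ(w)` — because the coaction is an algebra homomorphism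
(`coaction_mul`) and so is `Λ`. [cite: Brown2012, §2.4 I2 and (2.5)] -/
theorem Ψ_mul (u v : List Bool) :
    Ψ Γ.ρ Γ.γ u * Ψ Γ.ρ Γ.γ v = ((shuffleWord u v).map (Ψ Γ.ρ Γ.γ)).sum := by
  rw [← Λ_coactionG, ← Λ_coactionG, ← map_mul, Γ.coaction_mul, map_list_sum, List.map_map]
  exact congrArg List.sum (List.map_congr_left fun w _ => Γ.Λ_coactionG w)

/-- **I1: `Ψ(∅) = Iᵐ(0; ∅; 1) = 1`.** [cite: Brown2012, §2.4 I1] -/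
theorem Ψ_nil : Ψ Γ.ρ Γ.γ [] = 1 := by
  rw [Ψ, splittings]
  simp [galoisFactor, kept, Γ.χ_nil, Γ.ρ_nil]

/-- **(2.16): `Ψ(w) = Iᵐ(0; w; 1) ∈ 𝒰_{|w|}`** (the coaction is graded: Galois factor of degree the
gap length, `χ(kept)` of degree the number of kept letters). [cite: Brown2012, (2.16)] -/
theorem Ψ_mem (w : List Bool) : Ψ Γ.ρ Γ.γ w ∈ uW w.length := by
  rw [Ψ]
  refine list_sum_mem fun x hx => ?_
  obtain ⟨sp, hsp, rfl⟩ := List.mem_map.1 hx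
  rw [length_eq_gapLength_add hsp]
  exact mul_mem_uW (uPrime_le_uW _ (Γ.galoisFactor_mem _ _ _ _)) (Γ.χ_mem _)

/-- **I0 in degree one: `Ψ(a) = Iᵐ(0; a; 1) = 0`** for a letter `a` (`𝒰_1 = 0`).
[cite: Brown2012, §2.4 I0] -/
theorem Ψ_singleton (a : Bool) : Ψ Γ.ρ Γ.γ [a] = 0 :=
  eq_zero_of_mem_uW_one (Γ.Ψ_mem [a])

/-- **I0, second clause: `Ψ(aⁿ⁺¹) = Iᵐ(0; a…a; 1) = 0`** (divided powers of `Ψ(a) = 0`, using I2).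
[cite: Brown2012, §2.4 I0] -/
theorem Ψ_replicate_succ (n : ℕ) (a : Bool) : Ψ Γ.ρ Γ.γ (List.replicate (n + 1) a) = 0 :=
  apply_replicate_succ_eq_zero Γ.Ψ_mul a (Γ.Ψ_singleton a) n

/-- **The `f₂⁰`-part of `Ψ` is `ρ`**: `Ψ(u)(f₂⁰ f_b) = ρ(u)(f_b)` — the map `H → A` killing
`ζᵐ(2)` is induced by (2.6) (§2.3: "Thus the map `H → A` is induced by (2.6), and sends `ζᵐ(2)` to
zero"): only the splitting keeping no letter has `χ(kept)` of `f₂`-degree `0`.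
[cite: Brown2012, §2.3] -/
theorem Ψ_apply_zero (u : List Bool) (b : List ℕ) : Ψ Γ.ρ Γ.γ u (0, b) = Γ.ρ u (0, b) := by
  rw [Ψ, list_sum_apply, sum_splittings_eq_of_kept_ne_nil u
    (fun sp => (galoisFactor Γ.ρ false sp.1 sp.2 true * χ Γ.γ (kept sp.2)) (0, b))]
  · show (galoisFactor Γ.ρ false u [] true * χ Γ.γ (kept [])) (0, b) = Γ.ρ u (0, b)
    rw [kept, List.map_nil, Γ.χ_nil, mul_one, galoisFactor, Im_false_true]
  · intro sp _ hk
    rcases Nat.even_or_odd (kept sp.2).length with he | ho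
    · refine mul_apply_eq_zero_of_forall fun p hp q hq h1 => absurd h1 ?_
      have hp0 : p.1 = 0 := (mem_uPrime.1 (Γ.galoisFactor_mem _ _ _ _) p hp).2
      have hq' : q = ((kept sp.2).length / 2, []) := by
        classical
        by_contra hne
        exact hq (by rw [χ, single_apply, if_neg (Ne.symm hne)])
      rw [hq', hp0]
      have : 1 ≤ (kept sp.2).length := List.length_pos_iff.2 hk
      obtain ⟨k, hk2⟩ := he
      simp only; omega
    · rw [Γ.χ_of_odd ho, mul_zero, ShuffleMonoidAlgebra.zero_apply]

/-- `Iᵐ` with arbitrary endpoints commutes with taking the `f₂⁰`-part: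
`Iᵐ_Ψ(a; u; b)(f₂⁰ f_c) = Iᵐ_ρ(a; u; b)(f_c)`. [cite: Brown2012, §2.3 and §2.4 I0, I1, I3] -/
theorem Im_Ψ_apply_zero (a : Bool) (u : List Bool) (b : Bool) (c : List ℕ) :
    Im (Ψ Γ.ρ Γ.γ) a u b (0, c) = Im Γ.ρ a u b (0, c) := by
  unfold Im
  split_ifs
  · exact Γ.Ψ_apply_zero [] c
  · rfl
  · exact Γ.Ψ_apply_zero u c
  · rw [ShuffleMonoidAlgebra.smul_apply, ShuffleMonoidAlgebra.smul_apply, Γ.Ψ_apply_zero]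

/-! ### The infinitesimal coaction: `∂_{2r+1} Ψ` from coassociativity -/

/-- `∂_n` kills `χ(v) ∈ ℚ[f₂]`. [folklore] -/
theorem D_χ (n : ℕ) (v : List Bool) : D n (χ Γ.γ v) = 0 := by
  rw [χ, ← smul_e, map_smul, D_e_nil, smul_zero]

/-- **`∂_n Ψ(w) = Σ_{sp} [f_n](galoisFactor sp) · Ψ(kept sp)`** — the `(f∨_n ⊗ id) ∘ Δ'` of
Definition 3.1 on the constructed `Ψ(w) = Iᵐ(0;w;1)`, obtained from the coassociativity of the
coaction (`coaction_coassoc` at `a = f_n`) through `Λ`: `∂_n` is a derivation killing `ℚ[f₂]`, so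
`∂_n Ψ = Λ((L_{f_n} ⊗ id) Δ w) = Λ(Σ [f_n](galois) · Δ(kept)) = Σ [f_n](galois) Ψ(kept)`.
[cite: Brown2012, Definition 3.1 and proof of Theorem 3.3] -/
theorem D_Ψ (n : ℕ) (w : List Bool) :
    D n (Ψ Γ.ρ Γ.γ w) = ((splittings w).map fun sp =>
      galoisFactor Γ.ρ false sp.1 sp.2 true (0, [n]) • Ψ Γ.ρ Γ.γ (kept sp.2)).sum := by
  have h1 : D n (Ψ Γ.ρ Γ.γ w) = Γ.Λ (((splittings w).map fun sp =>
      (ShuffleMonoidAlgebra.single ((), kept sp.2)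
        (prefixCoeff [n] (galoisFactor Γ.ρ false sp.1 sp.2 true)) : UShuffle)).sum) := by
    rw [Ψ, map_list_sum, map_list_sum, List.map_map, List.map_map]
    refine congrArg List.sum (List.map_congr_left fun sp _ => ?_)
    rw [Function.comp_apply, Function.comp_apply, D_mul, D_χ, mul_zero, add_zero, Λ_single,
      prefixCoeff_singleton]
  rw [h1, Γ.coaction_coassoc w [n], map_list_sum, List.map_map]
  refine congrArg List.sum (List.map_congr_left fun sp _ => ?_)
  rw [Function.comp_apply, map_smul, Λ_coactionG, algebraMap_smul]

/-! ### From splittings to windows: (3.4) for the constructed `Ψ`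

Only the splittings with exactly one non-empty gap, of length `n`, have a Galois factor with a
non-zero coefficient of `f_n` ("`π` kills products" and the grading), and these are Brown's windows
`(a_p; a_{p+1} … a_{p+n}; a_{p+n+1})` with quotient sequence `quot`. -/

/-- A Galois factor all of whose gaps are empty is `1` (I1). [cite: Brown2012, §2.4 I1] -/
theorem galoisFactor_eq_one_of_gapLength_eq_zero :
    ∀ (y : Bool) (g : List Bool) (ps : List (Bool × List Bool)) (b : Bool),
      gapLength g ps = 0 → galoisFactor Γ.ρ y g ps b = 1
  | y, g, [], b, h => by
    have hg : g = [] := List.eq_nil_of_length_eq_zero (by rw [gapLength] at h; omega)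
    subst hg; rw [galoisFactor, Im_nil, Γ.ρ_nil]
  | y, g, p :: ps, b, h => by
    rw [gapLength, List.map_cons, List.sum_cons] at h
    have hg : g = [] := List.eq_nil_of_length_eq_zero (by omega)
    subst hg
    rw [galoisFactor, Im_nil, Γ.ρ_nil, one_mul]
    exact galoisFactor_eq_one_of_gapLength_eq_zero p.1 p.2 ps b (by rw [gapLength]; omega)

/-- The constant term of a Galois factor: `1` if all gaps are empty, `0` otherwise.
[cite: Brown2012, §2.4 I0, I1] -/
theorem galoisFactor_apply_zero_nil (y : Bool) (g : List Bool) (ps : List (Bool × List Bool))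
    (b : Bool) : galoisFactor Γ.ρ y g ps b (0, []) = if gapLength g ps = 0 then 1 else 0 := by
  split_ifs with h
  · rw [Γ.galoisFactor_eq_one_of_gapLength_eq_zero y g ps b h, one_def, e_def, single_apply_self]
  · exact apply_zero_nil_eq_zero_of_mem_uW (uPrime_le_uW _ (Γ.galoisFactor_mem y g ps b))
      (Nat.pos_of_ne_zero h)

/-- The endpoint after the first gap: the first kept letter, or the final endpoint `1` if nothing is
kept. [folklore] -/
def firstEndpoint (ps : List (Bool × List Bool)) : Bool := (ps.head?.map Prod.fst).getD true

/-- **The `f_n`-coefficient of a Galois factor with non-empty first gap** `g`: it is the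
`f_n`-coefficient of the first window `Iᵐ_ρ(y; g; first kept letter)` if all later gaps are empty,
and `0` otherwise ("`π` kills products"). [cite: Brown2012, (3.1) and (3.4)] -/
theorem galoisFactor_apply_zero_singleton_of_ne_nil (n : ℕ) (y : Bool) {g : List Bool}
    (hg : g ≠ []) (ps : List (Bool × List Bool)) :
    galoisFactor Γ.ρ y g ps true (0, [n]) =
      Im Γ.ρ y g (firstEndpoint ps) (0, [n]) * if gapLength [] ps = 0 then 1 else 0 := by
  cases ps with
  | nil => rw [galoisFactor, firstEndpoint, gapLength]; simp
  | cons p ps =>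
    rw [galoisFactor, mul_apply_zero_singleton, Γ.galoisFactor_apply_zero_nil,
      apply_zero_nil_eq_zero_of_mem_uW (uPrime_le_uW _ (Γ.Im_ρ_mem y g p.1))
        (List.length_pos_iff.2 hg), zero_mul, add_zero, firstEndpoint, List.head?_cons,
      Option.map_some, Option.getD_some]
    congr 2
    simp only [gapLength, List.length_nil, zero_add, List.map_cons, List.sum_cons]

/-- The splitting keeping every letter is the only one contributing to a sum whose terms vanish
unless all gaps are empty: `Σ_{sp ∈ splittings w} [gaps empty] F(kept) = F(w)`. [folklore] -/
theorem sum_splittings_ite_gapLength {N : Type*} [AddCommMonoid N] :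
    ∀ (w : List Bool) (F : List Bool → N),
      ((splittings w).map fun sp => if gapLength sp.1 sp.2 = 0 then F (kept sp.2) else 0).sum =
        F w
  | [], F => by simp [splittings, gapLength, kept]
  | c :: w, F => by
    rw [splittings, List.map_append, List.sum_append, List.map_map, List.map_map]
    have h1 : ((splittings w).map ((fun sp : List Bool × List (Bool × List Bool) =>
        if gapLength sp.1 sp.2 = 0 then F (kept sp.2) else 0) ∘
          fun p => (c :: p.1, p.2))).sum = 0 :=
      List.sum_eq_zero fun x hx => by
        obtain ⟨p, -, rfl⟩ := List.mem_map.1 hx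
        simp [gapLength]
    rw [h1, zero_add, ← sum_splittings_ite_gapLength w (fun v => F (c :: v))]
    refine congrArg List.sum (List.map_congr_left fun p _ => ?_)
    simp only [Function.comp_apply, gapLength, kept, List.length_nil, zero_add, List.map_cons,
      List.sum_cons]

/-- The endpoint after the letter of index `j` of `w` viewed inside `(…; w; 1)`: `w[j]`, or the final
`1` when `j = |w|`. [folklore] -/
def endpt (w : List Bool) (j : ℕ) : Bool := (w ++ [true]).getD j false

/-- The left endpoint `a_p` of the `p`-th window of `(x; v; 1)`: `x` for `p = 0`, `v[p-1]`
otherwise; for `x = 0` this is the tree's `lft v p`. [cite: Brown2012, (3.4)] -/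
def lftx (x : Bool) (v : List Bool) (p : ℕ) : Bool := (x :: (v ++ [true])).getD p false

/-- `lftx 0 = lft`. [cite: Brown2012, (3.4)] -/
theorem lftx_false (v : List Bool) (p : ℕ) : lftx false v p = lft v p := rfl

/-- `lftx x v 0 = x`. [folklore] -/
@[simp] theorem lftx_zero (x : Bool) (v : List Bool) : lftx x v 0 = x := rfl

/-- Shifting the windows of `c w` by one: left endpoints. [folklore] -/
theorem lftx_cons_succ (x c : Bool) (w : List Bool) (p : ℕ) :
    lftx x (c :: w) (p + 1) = lftx c w p := rfl

/-- Shifting the windows of `c w` by one: inner words. [folklore] -/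
theorem inner_cons_succ (c : Bool) (w : List Bool) (n p : ℕ) :
    inner (c :: w) n (p + 1) = inner w n p := rfl

/-- Shifting the windows of `c w` by one: right endpoints. [folklore] -/
theorem rgt_cons_succ (c : Bool) (w : List Bool) (n p : ℕ) :
    rgt (c :: w) n (p + 1) = rgt w n p := by
  simp only [rgt, aug, List.cons_append, show p + 1 + n + 1 = (p + n + 1) + 1 by omega,
    List.getD_cons_succ]

/-- Shifting the windows of `c w` by one: quotient sequences. [folklore] -/
theorem quot_cons_succ (c : Bool) (w : List Bool) (n p : ℕ) :
    quot (c :: w) n (p + 1) = c :: quot w n p := by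
  simp only [quot, List.take_succ_cons, show p + 1 + n = (p + n) + 1 by omega, List.drop_succ_cons,
    List.cons_append]

/-- The right endpoint of the initial window of length `k+1` of `c w`. [folklore] -/
theorem rgt_cons_zero_succ (c : Bool) (w : List Bool) (k : ℕ) :
    rgt (c :: w) (k + 1) 0 = endpt w k := by
  simp only [rgt, aug, endpt, List.cons_append, show 0 + (k + 1) + 1 = (k + 1) + 1 by omega,
    List.getD_cons_succ]

section windows

variable (n : ℕ) {N : Type*} [AddCommGroup N] [Module ℚ N]

/-- The splitting sum of `(x; g w; 1)` with a fixed NON-EMPTY initial gap segment `g` prepended,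
weighted by the `f_n`-coefficients of the Galois factors, in closed form: the single window starting
with `g` completed to length `n` (all other splittings have a vanishing coefficient, by the grading
and "`π` kills products"). [cite: Brown2012, (3.1) and (3.4)] -/
theorem sum_splittings_galoisFactor_append (x : Bool) :
    ∀ (w : List Bool) (g : List Bool) (_ : g ≠ []) (F : List Bool → N),
      ((splittings w).map fun sp =>
        galoisFactor Γ.ρ x (g ++ sp.1) sp.2 true (0, [n]) • F (kept sp.2)).sum =
      if g.length ≤ n ∧ n - g.length ≤ w.length then
        Im Γ.ρ x (g ++ w.take (n - g.length)) (endpt w (n - g.length)) (0, [n]) •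
          F (w.drop (n - g.length))
      else 0
  | [], g, hg, F => by
    rw [splittings, List.map_singleton, List.sum_singleton, List.append_nil, galoisFactor, kept,
      List.map_nil, List.length_nil]
    by_cases h : g.length = n
    · rw [if_pos ⟨h.le, by omega⟩, h, Nat.sub_self, List.take_nil, List.append_nil, List.drop_nil]
      rfl
    · rw [if_neg (by omega), apply_zero_singleton_eq_zero_of_mem_uW
        (uPrime_le_uW _ (Γ.Im_ρ_mem x g true)) h, zero_smul]
  | c :: w, g, hg, F => by
    rw [splittings, List.map_append, List.sum_append, List.map_map, List.map_map]
    -- first family: the initial gap grows by `c`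
    have h1 : ((splittings w).map ((fun sp : List Bool × List (Bool × List Bool) =>
        galoisFactor Γ.ρ x (g ++ sp.1) sp.2 true (0, [n]) • F (kept sp.2)) ∘
          fun p => (c :: p.1, p.2))).sum =
        ((splittings w).map fun sp =>
          galoisFactor Γ.ρ x ((g ++ [c]) ++ sp.1) sp.2 true (0, [n]) • F (kept sp.2)).sum :=
      congrArg List.sum (List.map_congr_left fun p _ => by
        rw [Function.comp_apply, List.append_assoc, List.singleton_append])
    -- second family: `c` is kept right after the gap `g`
    have h2 : ((splittings w).map ((fun sp : List Bool × List (Bool × List Bool) =>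
        galoisFactor Γ.ρ x (g ++ sp.1) sp.2 true (0, [n]) • F (kept sp.2)) ∘
          fun p => (([] : List Bool), (c, p.1) :: p.2))).sum =
        Im Γ.ρ x g c (0, [n]) • F (c :: w) := by
      have hterm : ∀ p ∈ splittings w, ((fun sp : List Bool × List (Bool × List Bool) =>
          galoisFactor Γ.ρ x (g ++ sp.1) sp.2 true (0, [n]) • F (kept sp.2)) ∘
            fun p => (([] : List Bool), (c, p.1) :: p.2)) p =
          Im Γ.ρ x g c (0, [n]) •
            (if gapLength p.1 p.2 = 0 then F (c :: kept p.2) else 0) := by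
        intro p _
        rw [Function.comp_apply, List.append_nil, galoisFactor, mul_apply_zero_singleton,
          apply_zero_nil_eq_zero_of_mem_uW (uPrime_le_uW _ (Γ.Im_ρ_mem x g c))
            (List.length_pos_iff.2 hg), zero_mul, add_zero, Γ.galoisFactor_apply_zero_nil,
          kept, List.map_cons]
        split_ifs
        · rw [mul_one]; rfl
        · rw [mul_zero, zero_smul, smul_zero]
      rw [List.map_congr_left hterm,
        show ((splittings w).map fun p => Im Γ.ρ x g c (0, [n]) •
            (if gapLength p.1 p.2 = 0 then F (c :: kept p.2) else 0)) =
          (((splittings w).map fun p : List Bool × List (Bool × List Bool) =>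
            if gapLength p.1 p.2 = 0 then F (c :: kept p.2) else 0).map
              (Im Γ.ρ x g c (0, [n]) • ·)) from (List.map_map ..).symm,
        ← List.smul_sum, sum_splittings_ite_gapLength w (fun v => F (c :: v))]
    rw [h1, h2, sum_splittings_galoisFactor_append x w (g ++ [c]) (by simp) F, List.length_append,
      List.length_singleton, List.length_cons]
    rcases Nat.lt_trichotomy g.length n with hlt | heq | hgt
    · -- the window is completed inside `c w`
      rw [apply_zero_singleton_eq_zero_of_mem_uW (uPrime_le_uW _ (Γ.Im_ρ_mem x g c)) hlt.ne,
        zero_smul, add_zero]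
      obtain ⟨k, hk⟩ : ∃ k, n - g.length = k + 1 := ⟨n - g.length - 1, by omega⟩
      rw [hk, show n - (g.length + 1) = k by omega]
      by_cases hc : k ≤ w.length
      · rw [if_pos ⟨by omega, hc⟩, if_pos ⟨hlt.le, by omega⟩, List.take_succ_cons,
          List.drop_succ_cons, List.append_assoc, List.singleton_append]
        simp only [endpt, List.cons_append, List.getD_cons_succ]
      · rw [if_neg (by omega), if_neg (by omega)]
    · -- the window is exactly `g`, closed by the kept letter `c`
      rw [if_neg (by omega), zero_add, if_pos ⟨heq.le, by omega⟩, heq, Nat.sub_self, List.take_zero,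
        List.append_nil, List.drop_zero]
      simp only [endpt, List.cons_append, List.getD_cons_zero]
    · -- `g` is already too long
      rw [if_neg (by omega), zero_add, if_neg (by omega),
        apply_zero_singleton_eq_zero_of_mem_uW (uPrime_le_uW _ (Γ.Im_ρ_mem x g c)) hgt.ne',
        zero_smul]

/-- **From splittings to windows** ((3.4) for the constructed objects): weighting the splittings
of `(x; v; 1)` by the `f_n`-coefficient of their Galois factor (`n ≥ 1`) leaves exactly Brown's
windows — the consecutive subsequences `(a_p; a_{p+1} … a_{p+n}; a_{p+n+1})` of length `n`, with
the quotient sequence kept. [cite: Brown2012, (3.4)] -/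
theorem sum_splittings_galoisFactor_eq_sum_windows (hn : 1 ≤ n) :
    ∀ (x : Bool) (v : List Bool) (F : List Bool → N),
      ((splittings v).map fun sp =>
        galoisFactor Γ.ρ x sp.1 sp.2 true (0, [n]) • F (kept sp.2)).sum =
      ∑ p ∈ Finset.range (v.length + 1 - n),
        Im Γ.ρ (lftx x v p) (inner v n p) (rgt v n p) (0, [n]) • F (quot v n p)
  | x, [], F => by
    rw [splittings, List.map_singleton, List.sum_singleton, galoisFactor, Im_nil, Γ.ρ_nil, kept,
      List.map_nil, List.length_nil, show 0 + 1 - n = 0 by omega, Finset.range_zero,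
      Finset.sum_empty, one_def, e_def, single_apply_of_ne (by simp), zero_smul]
  | x, c :: w, F => by
    rw [splittings, List.map_append, List.sum_append, List.map_map, List.map_map]
    have h1 : ((splittings w).map ((fun sp : List Bool × List (Bool × List Bool) =>
        galoisFactor Γ.ρ x sp.1 sp.2 true (0, [n]) • F (kept sp.2)) ∘
          fun p => (c :: p.1, p.2))).sum =
        ((splittings w).map fun sp =>
          galoisFactor Γ.ρ x ([c] ++ sp.1) sp.2 true (0, [n]) • F (kept sp.2)).sum :=
      congrArg List.sum (List.map_congr_left fun p _ => rfl)
    have h2 : ((splittings w).map ((fun sp : List Bool × List (Bool × List Bool) =>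
        galoisFactor Γ.ρ x sp.1 sp.2 true (0, [n]) • F (kept sp.2)) ∘
          fun p => (([] : List Bool), (c, p.1) :: p.2))).sum =
        ((splittings w).map fun sp =>
          galoisFactor Γ.ρ c sp.1 sp.2 true (0, [n]) • (F ∘ (c :: ·)) (kept sp.2)).sum :=
      congrArg List.sum (List.map_congr_left fun p _ => by
        simp only [Function.comp_apply, galoisFactor, Im_nil, Γ.ρ_nil, one_mul, kept,
          List.map_cons])
    rw [h1, h2, Γ.sum_splittings_galoisFactor_append n x w [c] (List.cons_ne_nil c []) F,
      sum_splittings_galoisFactor_eq_sum_windows hn c w (F ∘ (c :: ·)), List.length_singleton,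
      List.length_cons]
    by_cases hle : n ≤ w.length + 1
    · rw [if_pos ⟨hn, by omega⟩, show w.length + 1 + 1 - n = (w.length + 1 - n) + 1 by omega,
        Finset.sum_range_succ', add_comm]
      congr 1
      · refine Finset.sum_congr rfl fun p _ => ?_
        rw [lftx_cons_succ, inner_cons_succ, rgt_cons_succ, quot_cons_succ, Function.comp_apply]
      · obtain ⟨k, rfl⟩ : ∃ k, n = k + 1 := ⟨n - 1, by omega⟩
        rw [lftx_zero, inner_zero, quot_zero, rgt_cons_zero_succ, Nat.add_sub_cancel,
          List.take_succ_cons, List.drop_succ_cons, List.singleton_append]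
    · rw [if_neg (by omega), zero_add, show w.length + 1 + 1 - n = 0 by omega,
        show w.length + 1 - n = 0 by omega, Finset.range_zero, Finset.sum_empty, Finset.sum_empty]

end windows

/-- **(3.4) for the constructed motivic iterated integrals**:
`∂_{2r+1} Ψ(v) = Σ_{p=0}^{N-n} [f_{2r+1}] Iᵐ_ρ(a_p; a_{p+1}…a_{p+n}; a_{p+n+1}) · Ψ(quotient)`,
`n = 2r+1` — Definition 3.1's `D_{2r+1}` contracted with `f^∨_{2r+1}`, computed by Goncharov's
formula (Theorem 2.4): `D_Ψ` (coassociativity) rewritten through the windows ("`π` kills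
products"). [cite: Brown2012, Definition 3.1, (3.4) and Theorem 2.4] -/
theorem D_Ψ_eq_sum_windows (r : ℕ) (v : List Bool) :
    D (2 * r + 1) (Ψ Γ.ρ Γ.γ v) = ∑ p ∈ Finset.range (v.length + 1 - (2 * r + 1)),
      Im Γ.ρ (lft v p) (inner v (2 * r + 1) p) (rgt v (2 * r + 1) p) (0, [2 * r + 1]) •
        Ψ Γ.ρ Γ.γ (quot v (2 * r + 1) p) := by
  rw [D_Ψ]
  exact Γ.sum_splittings_galoisFactor_eq_sum_windows (2 * r + 1) (by omega) false v (Ψ Γ.ρ Γ.γ)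

/-! ### The period map as an algebra homomorphism -/

/-- **The period map on `𝒰`**: evaluation at the real point `(g, t₀)`, `f₂^m f_b ↦ t₀^m g(b)`, an
algebra homomorphism because `g` is a character (universal property). [cite: Brown2012, (2.11)] -/
def perAlg : UAlg →ₐ[ℚ] ℝ :=
  lift (fun p => Γ.t₀ ^ p.1 * Γ.g p.2) (by rw [pow_zero, Γ.g_nil, mul_one]) (by
    rintro ⟨m, a⟩ ⟨m', b⟩
    dsimp only
    rw [mul_mul_mul_comm, ← pow_add, Γ.g_mul, ← List.sum_map_mul_left])

/-- `perAlg` is the linear functional `perLin g t₀`. [cite: Brown2012, (2.11)] -/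
theorem perAlg_apply (x : UAlg) : Γ.perAlg x = perLin Γ.g Γ.t₀ x := rfl

/-- **(2.19) for the constructed objects**: `per Ψ(ρ(n₁,…,n_r)) = ζ(n₁,…,n_r)`, `n_r ≥ 2`, in the
tree's orientation of `multipleZeta`. [cite: Brown2012, (2.11), (2.19)] -/
theorem perAlg_Ψ_rho {s : List ℕ} (hs : IsAdmissible s) :
    Γ.perAlg (Ψ Γ.ρ Γ.γ (rho s.reverse)) = multipleZeta s :=
  Γ.period s hs

/-! ## Brown's algebra `H ⊆ 𝒰` -/

/-- Brown's `H` as a subspace of `𝒰`: the span of the `Ψ(w) = Iᵐ(0; w; 1)` — the image of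
`𝒪(₀Π₁) → H ↪ H^{MT⁺} ≅ 𝒰` (Def. 2.1, (2.15), (2.22)). [cite: Brown2012, Definition 2.1 and (2.15)] -/
def Hsub : Submodule ℚ UAlg := Submodule.span ℚ (Set.range (Ψ Γ.ρ Γ.γ))

/-- `Iᵐ(0; w; 1) ∈ H`. [cite: Brown2012, (2.8)] -/
theorem Ψ_mem_Hsub (w : List Bool) : Ψ Γ.ρ Γ.γ w ∈ Γ.Hsub := Submodule.subset_span ⟨w, rfl⟩

/-- `1 = Iᵐ(0; ∅; 1) ∈ H`. [cite: Brown2012, §2.4 I1] -/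
theorem one_mem_Hsub : (1 : UAlg) ∈ Γ.Hsub := Γ.Ψ_nil ▸ Γ.Ψ_mem_Hsub []

/-- **`H` is closed under products** (I2: the `Iᵐ(0;w;1)` multiply by the shuffle product).
[cite: Brown2012, Definition 2.1 and §2.4 I2] -/
theorem mul_mem_Hsub {x y : UAlg} (hx : x ∈ Γ.Hsub) (hy : y ∈ Γ.Hsub) : x * y ∈ Γ.Hsub := by
  have h : Γ.Hsub * Γ.Hsub ≤ Γ.Hsub := by
    rw [Hsub, Submodule.span_mul_span, Submodule.span_le]
    rintro _ ⟨_, ⟨u, rfl⟩, _, ⟨v, rfl⟩, rfl⟩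
    rw [SetLike.mem_coe]
    change Ψ Γ.ρ Γ.γ u * Ψ Γ.ρ Γ.γ v ∈ _
    rw [Γ.Ψ_mul]
    exact list_sum_mem fun z hz => by
      obtain ⟨s, -, rfl⟩ := List.mem_map.1 hz
      exact Γ.Ψ_mem_Hsub s
  exact h (Submodule.mul_mem_mul hx hy)

/-- **Brown's algebra `H` of motivic multiple zeta values, realised inside `𝒰`** (Definition 2.1
through (2.15) and (2.22)): a `ℚ`-subalgebra of `𝒰`. [cite: Brown2012, Definition 2.1, (2.15), (2.22)] -/
def Halg : Subalgebra ℚ UAlg :=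
  Γ.Hsub.toSubalgebra Γ.one_mem_Hsub fun _ _ => Γ.mul_mem_Hsub

/-- Membership in `H` is membership in the span. [folklore] -/
theorem mem_Halg {x : UAlg} : x ∈ Γ.Halg ↔ x ∈ Γ.Hsub := Iff.rfl

/-- **`H` is stable under the `∂_n`** (it is a subcomodule: `∂_n Iᵐ(0;w;1)` is a combination of
`Iᵐ(0;w';1)`'s by coassociativity, `D_Ψ`). [cite: Brown2012, (2.10) and Definition 3.1] -/
theorem D_mem_Hsub (n : ℕ) {x : UAlg} (hx : x ∈ Γ.Hsub) : D n x ∈ Γ.Hsub := by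
  have h : Γ.Hsub ≤ Γ.Hsub.comap (D n) := by
    rw [Hsub, Submodule.span_le]
    rintro _ ⟨w, rfl⟩
    rw [SetLike.mem_coe, Submodule.mem_comap, Γ.D_Ψ]
    exact list_sum_mem fun z hz => by
      obtain ⟨sp, -, rfl⟩ := List.mem_map.1 hz
      exact Submodule.smul_mem _ _ (Submodule.subset_span ⟨_, rfl⟩)
  exact h hx

/-- **Brown's `∂ʰ_{2r+1} = (f^∨_{2r+1} ⊗ id) ∘ D_{2r+1} : H → H`** (Definition 3.1 contracted as in
the proof of Lemma 2.7): the restriction of `∂_{2r+1}` to `H ⊆ 𝒰`.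
[cite: Brown2012, Definition 3.1 and proof of Lemma 2.7] -/
def dH (r : ℕ) : Γ.Halg →ₗ[ℚ] Γ.Halg where
  toFun x := ⟨D (2 * r + 1) (x : UAlg), Γ.D_mem_Hsub _ x.2⟩
  map_add' _ _ := Subtype.ext (map_add _ _ _)
  map_smul' _ _ := Subtype.ext (map_smul _ _ _)

/-- `∂ʰ` is `∂` on the underlying elements of `𝒰`. [cite: Brown2012, Definition 3.1] -/
@[simp] theorem coe_dH (r : ℕ) (x : Γ.Halg) : (Γ.dH r x : UAlg) = D (2 * r + 1) (x : UAlg) := rfl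

/-- The weight-`N` piece `H_N = H ∩ 𝒰_N`. [cite: Brown2012, (2.7) and (2.16)] -/
def Hw (N : ℕ) : Submodule ℚ Γ.Halg := (uW N).comap Γ.Halg.val.toLinearMap

/-- `x ∈ H_N ↔ x ∈ 𝒰_N`. [cite: Brown2012, (2.16)] -/
theorem mem_Hw {N : ℕ} {x : Γ.Halg} : x ∈ Γ.Hw N ↔ (x : UAlg) ∈ uW N := Iff.rfl

/-- **The motivic iterated integrals `J u = Iᵐ(0; u; 1) ∈ H`** ((2.8)): the constructed `Ψ(u)`.
[cite: Brown2012, (2.8)] -/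
def J (u : List Bool) : Γ.Halg := ⟨Ψ Γ.ρ Γ.γ u, Γ.Ψ_mem_Hsub u⟩

/-- `J u` is `Ψ u` in `𝒰`. [cite: Brown2012, (2.8) and (2.15)] -/
@[simp] theorem coe_J (u : List Bool) : (Γ.J u : UAlg) = Ψ Γ.ρ Γ.γ u := rfl

/-- **`φ : H ↪ 𝒰`** in the coordinates `ℕ × List ℕ →₀ ℚ` of `BrownDepthOneLift`: the inclusion
((2.15) with (2.22)). [cite: Brown2012, (2.15) and (2.22)] -/
def φ : Γ.Halg →ₗ[ℚ] (ℕ × List ℕ →₀ ℚ) :=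
  (toFinsuppL (M := ℕ) (α := ℕ) (R := ℚ)).toLinearMap ∘ₗ Γ.Halg.val.toLinearMap

/-- `φ x (p) = x(p)`. [folklore] -/
@[simp] theorem φ_apply (x : Γ.Halg) (p : ℕ × List ℕ) : Γ.φ x p = (x : UAlg) p := rfl

/-- `φ` is injective. [cite: Brown2012, (2.15)] -/
theorem φ_injective : Function.Injective Γ.φ := fun x y h =>
  Subtype.ext (toFinsuppL.injective (by simpa [φ] using h))

/-- A finite sum in `H`, seen in `𝒰`. [folklore] -/
theorem coe_finset_sum {ι : Type*} (s : Finset ι) (f : ι → Γ.Halg) :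
    ((∑ i ∈ s, f i : Γ.Halg) : UAlg) = ∑ i ∈ s, (f i : UAlg) :=
  map_sum Γ.Halg.val f s

/-- `Iᵐ` with arbitrary endpoints commutes with the inclusion `H ⊆ 𝒰`. [cite: Brown2012, §2.4] -/
theorem coe_Im_J (a : Bool) (u : List Bool) (b : Bool) :
    ((Im Γ.J a u b : Γ.Halg) : UAlg) = Im (Ψ Γ.ρ Γ.γ) a u b := by
  unfold Im
  split_ifs <;> simp

/-! ## (3.8) for the constructed objects: `ζᵐ₁(2ⁿ) = -2 Σ ζᵐ(2ⁱ 3 2ⁿ⁻¹⁻ⁱ)` from I2 -/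

/-- The shuffles of a letter into a word are its insertions, in order of position. [folklore] -/
theorem shuffleWord_singleton_left {α : Type*} (a : α) :
    ∀ w : List α, shuffleWord [a] w = (List.range (w.length + 1)).map fun i =>
      w.take i ++ a :: w.drop i
  | [] => by simp
  | c :: w => by
    rw [shuffleWord_cons_cons, shuffleWord_nil_left, List.map_singleton,
      shuffleWord_singleton_left a w, List.map_map, List.length_cons,
      List.range_succ_eq_map (n := w.length + 1), List.map_cons, List.map_map]
    rfl

/-- A list sum over `List.range` is a `Finset.range` sum. [folklore] -/
theorem sum_map_range_eq_finset_sum {N : Type*} [AddCommMonoid N] (f : ℕ → N) :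
    ∀ m : ℕ, ((List.range m).map f).sum = ∑ i ∈ Finset.range m, f i
  | 0 => by simp
  | m + 1 => by
    rw [List.range_succ, List.map_append, List.sum_append, List.map_singleton, List.sum_singleton,
      sum_map_range_eq_finset_sum f m, Finset.sum_range_succ]

/-- Pairing consecutive terms: `Σ_{i<2n} f(i) = Σ_{j<n} (f(2j) + f(2j+1))`. [folklore] -/
theorem sum_range_two_mul {N : Type*} [AddCommMonoid N] (f : ℕ → N) :
    ∀ n : ℕ, ∑ i ∈ Finset.range (2 * n), f i = ∑ j ∈ Finset.range n, (f (2 * j) + f (2 * j + 1))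
  | 0 => by simp
  | n + 1 => by
    rw [show 2 * (n + 1) = 2 * n + 1 + 1 by ring, Finset.sum_range_succ, Finset.sum_range_succ,
      sum_range_two_mul f n, Finset.sum_range_succ, add_assoc]

/-- `ρ(2ᵏ) = (10)ᵏ`. [cite: Brown2012, Definition 2.1 (2.10)] -/
theorem rho_replicate_two (k : ℕ) :
    rho (List.replicate k 2) = (List.replicate k [true, false]).flatten := by
  induction k with
  | zero => rfl
  | succ k ih => rw [List.replicate_succ, rho_cons, ih, List.replicate_succ, List.flatten_cons]; rfl

/-- `|(10)ᵏ| = 2k`. [folklore] -/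
theorem length_flatten_replicate_tf (k : ℕ) :
    ((List.replicate k [true, false]).flatten).length = 2 * k := by
  induction k with
  | zero => rfl
  | succ k ih => rw [List.replicate_succ, List.flatten_cons, List.length_append, ih]; simp; ring

/-- `ρ(2ʲ 3 2ᵐ) = (10)ʲ 100 (10)ᵐ`. [cite: Brown2012, Definition 2.1 (2.10)] -/
theorem rho_twos_three_twos (j m : ℕ) :
    rho (List.replicate j 2 ++ 3 :: List.replicate m 2) =
      (List.replicate j [true, false]).flatten ++ true :: false :: false ::
        (List.replicate m [true, false]).flatten := by
  rw [rho_append, rho_cons, rho_replicate_two, rho_replicate_two]; rfl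

/-- Inserting a `0` right after the `j`-th `1`, or one step later, in `(10)ⁿ` gives `(10)ʲ100(10)ⁿ⁻¹⁻ʲ`
(the two insertions of (3.8) producing the same word). [cite: Brown2012, (3.8)] -/
theorem insert_false_rho_replicate_two {n j : ℕ} (hj : j < n) (e : ℕ) (he : e = 1 ∨ e = 2) :
    (rho (List.replicate n 2)).take (2 * j + e) ++ false :: (rho (List.replicate n 2)).drop (2 * j + e) =
      rho (List.replicate j 2 ++ 3 :: List.replicate (n - 1 - j) 2) := by
  obtain ⟨m, rfl⟩ : ∃ m, n = j + 1 + m := ⟨n - 1 - j, by omega⟩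
  rw [show j + 1 + m - 1 - j = m by omega, rho_twos_three_twos, rho_replicate_two,
    show j + 1 + m = j + (1 + m) by ring, List.replicate_add, List.flatten_append,
    List.replicate_add, List.flatten_append, List.replicate_one, List.flatten_singleton]
  set A := (List.replicate j [true, false]).flatten with hA
  set B := (List.replicate m [true, false]).flatten with hB
  have hlen : A.length = 2 * j := length_flatten_replicate_tf j
  rcases he with rfl | rfl
  · rw [show 2 * j + 1 = A.length + 1 by rw [hlen], List.take_append, List.drop_append,
      List.take_of_length_le (by omega), List.drop_of_length_le (by omega)]
    simp
  · rw [show 2 * j + 2 = A.length + 2 by rw [hlen], List.take_append, List.drop_append,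
      List.take_of_length_le (by omega), List.drop_of_length_le (by omega)]
    simp

/-- **(3.8) for the constructed motivic iterated integrals**:
`Ψ(0 (10)ⁿ) = -2 Σ_{i<n} Ψ((10)ⁱ 100 (10)ⁿ⁻¹⁻ⁱ)`, i.e. `ζᵐ₁(2ⁿ) = -2 Σ ζᵐ(2ⁱ 3 2ⁿ⁻¹⁻ⁱ)` — from
I2 (`Ψ` is multiplicative) and `Ψ(0) = 0`: the shuffle `0 ш (10)ⁿ` inserts the `0` in front (giving
`ζᵐ₁(2ⁿ)`) or inside a block `10`, in two ways, giving `100`. [cite: Brown2012, (3.8) and §2.4 I2] -/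
theorem Ψ_zetaOne (n : ℕ) :
    Ψ Γ.ρ Γ.γ (false :: rho (List.replicate n 2)) = -2 * ∑ i ∈ Finset.range n,
      Ψ Γ.ρ Γ.γ (rho (List.replicate i 2 ++ 3 :: List.replicate (n - 1 - i) 2)) := by
  set v := rho (List.replicate n 2) with hv
  have hlen : v.length = 2 * n := by rw [hv, rho_replicate_two, length_flatten_replicate_tf]
  have h := Γ.Ψ_mul [false] v
  rw [Γ.Ψ_singleton, zero_mul, shuffleWord_singleton_left, List.map_map,
    sum_map_range_eq_finset_sum, hlen, Finset.sum_range_succ', sum_range_two_mul] at h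
  simp only [Function.comp_apply, List.take_zero, List.drop_zero, List.nil_append] at h
  have hpair : ∀ j ∈ Finset.range n,
      Ψ Γ.ρ Γ.γ (v.take (2 * j + 1) ++ false :: v.drop (2 * j + 1)) +
        Ψ Γ.ρ Γ.γ (v.take (2 * j + 1 + 1) ++ false :: v.drop (2 * j + 1 + 1)) =
      2 * Ψ Γ.ρ Γ.γ (rho (List.replicate j 2 ++ 3 :: List.replicate (n - 1 - j) 2)) := by
    intro j hj
    rw [Finset.mem_range] at hj
    rw [hv, insert_false_rho_replicate_two hj 1 (Or.inl rfl),
      show 2 * j + 1 + 1 = 2 * j + 2 by ring, insert_false_rho_replicate_two hj 2 (Or.inr rfl),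
      two_mul]
  rw [Finset.sum_congr rfl hpair, ← Finset.mul_sum] at h
  linear_combination -h

/-! ## The construction -/

/-- **Brown's motivic MZV package, CONSTRUCTED from the Deligne–Goncharov Galois data** (Brown
2012, §§2.2–2.5 and §3.1 as theorems): `H ⊆ 𝒰` the subalgebra spanned by the
`Ψ(w) = Iᵐ(0;w;1)`, graded by `H ∩ 𝒰_N`, `per = ev_{(g,t₀)}`, `φ` the inclusion, `∂ʰ = ∂|_H`; the
seventeen fields of `MotivicMZV` are then: the grading of the coaction ((2.16)), I1, I0, the period
identity ((2.19)), injectivity (free), the Leibniz rule ((3.3)), Goncharov's formula contracted to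
(3.4), "`π` kills products" ((3.1)), and (3.8) from I2.
[cite: Brown2012, §2.2–§2.5, §3.1, (3.8)] -/
def toMotivicMZV : MotivicMZV where
  H := Γ.Halg
  Hw := Γ.Hw
  mul_mem hx hy := mul_mem_uW hx hy
  J := Γ.J
  J_mem u := Γ.Ψ_mem u
  J_nil := Subtype.ext Γ.Ψ_nil
  J_replicate m b := Subtype.ext (Γ.Ψ_replicate_succ m b)
  per := Γ.perAlg.comp Γ.Halg.val
  per_J s hs := Γ.perAlg_Ψ_rho hs
  φ := Γ.φ
  φ_mem _ _ hx := hx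
  φ_inj _ := Γ.φ_injective.injOn
  dH := Γ.dH
  φ_dH _ _ _ := Finsupp.ext fun _ => rfl
  dH_mul _ x y := by
    apply Subtype.ext
    simp only [coe_dH, Subalgebra.coe_mul, Subalgebra.coe_add, D_mul]
    ring
  dH_J r _ v := by
    apply Subtype.ext
    rw [coe_dH, coe_J, Γ.D_Ψ_eq_sum_windows r v, coe_finset_sum]
    refine Finset.sum_congr rfl fun p _ => ?_
    rw [Subalgebra.coe_smul, coe_J, φ_apply, coe_Im_J, Γ.Im_Ψ_apply_zero]
  coeff_mul r a b x y ha hb hx hy := mul_apply_zero_singleton_eq_zero ha hb hx hy _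
  zetaOne n _ := by
    apply Subtype.ext
    have h2 : ((-2 : Γ.Halg) : UAlg) = -2 := by
      change Γ.Halg.val (-2) = -2
      rw [map_neg, map_ofNat]
    rw [coe_J, Γ.Ψ_zetaOne n, Subalgebra.coe_mul, coe_finset_sum, h2]
    rfl

/-- **`Nonempty MotivicGaloisData → motivicMZV_nonempty`**: Brown's package exists as soon as the
Deligne–Goncharov input of §2.1 and §2.3 is given — the apex fact `motivicMZV_nonempty` reduced to
the Galois data. [cite: Brown2012, §2 and §3.1] -/
theorem _root_.Literature.NumberTheory.Transcendental.Brown2012.motivicMZV_nonempty_of_galoisData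
    (h : Nonempty MotivicGaloisData) : motivicMZV_nonempty :=
  h.elim fun Γ => ⟨Γ.toMotivicMZV⟩

end MotivicGaloisData

end Brown2012

end Literature.NumberTheory.Transcendental
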